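import Summits.ValiantsHypothesis.ValiantsHypothesis.Theorems.SymPencilPerFourInnerRankSlotKernel

/-!
# Route `SymPencil` — inner rank of the `2 | 2` row split of `per_4`: point-wise consequences of
# the one-sided shapes of the `a`-slot kernel, and the `y₂ ↔ y₃` symmetry
# (`--supports` stmt-ValiantsHypothesis-5674 `SdcSuperquadratic`; (8,8) column, isotropic-kernel route,
# bridge step (B3) of memo `NOTE-p6g15-5674-IR12-reduction.md` §8)

* `minors_of_fst` / `minors_of_snd`: if the `a`-slot kernel `K_a` (dimension `≥ 3`) is contained
  in `K⁴ ⊕ 0` (resp. `0 ⊕ K⁴`), then the `y₂`-block (resp. `y₃`-block) of the `a`-part has rank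
  `≤ 1` at `a`, stated as the vanishing of all `2 × 2` minors
  `t_r((a,0),(e_k,0)) t_{r'}((a,0),(e_{k'},0)) - t_r((a,0),(e_{k'},0)) t_{r'}((a,0),(e_k,0))`.
* `hJ_yswap`: the joint identity is invariant under `y₂ ↔ y₃` (general index type; the `Fin 8`
  version is `SymPencilPerFourInnerRankPairs.hJ_yswap`).
* `mem_ker_yswap`: the `a`-slot kernel of the swapped design is the swap of the kernel.

Honest framing: glue in a conditional reduction of the cells `(8,8,10)`, `(8,8,11)`; nothing about
the window, the crux or `VP ≠ VNP`.  No definitions, no named facts. [folklore]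
-/

noncomputable section

-- single-conjunct layout: Sub = Summit, duplicated namespace component intended
set_option linter.dupNamespace false

namespace Summit.ValiantsHypothesis.ValiantsHypothesis.Theorems.SymPencilPerFourInnerRankSlotAShapes

open Matrix Finset Module
open Summit.ValiantsHypothesis.ValiantsHypothesis.Theorems.SymPencilPerFourInnerRankRows

variable {K : Type*} [Field K] {ι : Type*}

/-- Rank `≤ 1` of a linear map out of `K⁴` with kernel of dimension `≥ 3`, as vanishing of the
`2 × 2` minors of two image vectors. [folklore] -/
theorem minors_of_three_le_finrank_ker (A : (Fin 4 → K) →ₗ[K] (ι → K))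
    (h3 : 3 ≤ finrank K (LinearMap.ker A)) (x x' : Fin 4 → K) (r r' : ι) :
    A x r * A x' r' - A x' r * A x r' = 0 := by
  have hrk : finrank K (LinearMap.range A) ≤ 1 := by
    have h := LinearMap.finrank_range_add_finrank_ker A
    rw [finrank_fintype_fun_eq_card, Fintype.card_fin] at h
    omega
  obtain ⟨v₀, hv₀⟩ := finrank_le_one_iff.1 hrk
  obtain ⟨c₁, hc₁⟩ := hv₀ ⟨A x, LinearMap.mem_range_self A x⟩
  obtain ⟨c₂, hc₂⟩ := hv₀ ⟨A x', LinearMap.mem_range_self A x'⟩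
  have e₁ : A x = c₁ • (v₀ : ι → K) := by simpa using (congrArg Subtype.val hc₁).symm
  have e₂ : A x' = c₂ • (v₀ : ι → K) := by simpa using (congrArg Subtype.val hc₂).symm
  rw [e₁, e₂]
  simp only [Pi.smul_apply, smul_eq_mul]
  ring

/-- **One-sided (`fst`) kernel ⇒ rank of the `y₂`-block `≤ 1` at `a`.** [folklore] -/
theorem minors_of_fst
    (t : ι → (((Fin 4 → K) × (Fin 4 → K)) →ₗ[K] ((Fin 4 → K) × (Fin 4 → K)) →ₗ[K] K))
    (a : Fin 4 → K) (h3 : 3 ≤ finrank K (LinearMap.ker (LinearMap.pi fun r => t r (a, 0))))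
    (hfst : ∀ w ∈ LinearMap.ker (LinearMap.pi fun r => t r (a, 0)), w.2 = 0)
    (x x' : Fin 4 → K) (r r' : ι) :
    t r (a, 0) (x, 0) * t r' (a, 0) (x', 0) - t r (a, 0) (x', 0) * t r' (a, 0) (x, 0) = 0 := by
  set W := LinearMap.ker (LinearMap.pi fun r => t r (a, 0)) with hW
  let A : (Fin 4 → K) →ₗ[K] (ι → K) :=
    (LinearMap.pi fun r => t r (a, 0)) ∘ₗ LinearMap.inl K (Fin 4 → K) (Fin 4 → K)
  have hA : ∀ y r, A y r = t r (a, 0) (y, 0) := fun y r => rfl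
  -- `w ↦ w.1` maps `W` injectively into `ker A`
  have h3' : 3 ≤ finrank K (LinearMap.ker A) := by
    let f : W →ₗ[K] LinearMap.ker A :=
      { toFun := fun w => ⟨(w : (Fin 4 → K) × (Fin 4 → K)).1, by
          rw [LinearMap.mem_ker]
          have hw : (LinearMap.pi fun r => t r (a, 0)) (w : (Fin 4 → K) × (Fin 4 → K)) = 0 :=
            LinearMap.mem_ker.1 w.2
          have h2 := hfst w w.2
          have : ((w : (Fin 4 → K) × (Fin 4 → K)).1, (0 : Fin 4 → K)) = (w : _) := by
            rw [← h2]
          show (LinearMap.pi fun r => t r (a, 0)) ((w : (Fin 4 → K) × (Fin 4 → K)).1, 0) = 0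
          rw [this]; exact hw⟩
        map_add' := fun w w' => by ext; simp
        map_smul' := fun c w => by ext; simp }
    have hf : Function.Injective f := by
      intro w w' h
      have h1 : (w : (Fin 4 → K) × (Fin 4 → K)).1 = (w' : (Fin 4 → K) × (Fin 4 → K)).1 :=
        congrArg Subtype.val h
      apply Subtype.ext
      exact Prod.ext h1 (by rw [hfst w w.2, hfst w' w'.2])
    calc 3 ≤ finrank K W := h3
      _ = finrank K (LinearMap.range f) := (LinearMap.finrank_range_of_inj hf).symm
      _ ≤ finrank K (LinearMap.ker A) := Submodule.finrank_le _
  have := minors_of_three_le_finrank_ker A h3' x x' r r'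
  simpa only [hA] using this

/-- **One-sided (`snd`) kernel ⇒ rank of the `y₃`-block `≤ 1` at `a`.** [folklore] -/
theorem minors_of_snd
    (t : ι → (((Fin 4 → K) × (Fin 4 → K)) →ₗ[K] ((Fin 4 → K) × (Fin 4 → K)) →ₗ[K] K))
    (a : Fin 4 → K) (h3 : 3 ≤ finrank K (LinearMap.ker (LinearMap.pi fun r => t r (a, 0))))
    (hsnd : ∀ w ∈ LinearMap.ker (LinearMap.pi fun r => t r (a, 0)), w.1 = 0)
    (x x' : Fin 4 → K) (r r' : ι) :
    t r (a, 0) (0, x) * t r' (a, 0) (0, x') - t r (a, 0) (0, x') * t r' (a, 0) (0, x) = 0 := by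
  set W := LinearMap.ker (LinearMap.pi fun r => t r (a, 0)) with hW
  let A : (Fin 4 → K) →ₗ[K] (ι → K) :=
    (LinearMap.pi fun r => t r (a, 0)) ∘ₗ LinearMap.inr K (Fin 4 → K) (Fin 4 → K)
  have hA : ∀ y r, A y r = t r (a, 0) (0, y) := fun y r => rfl
  have h3' : 3 ≤ finrank K (LinearMap.ker A) := by
    let f : W →ₗ[K] LinearMap.ker A :=
      { toFun := fun w => ⟨(w : (Fin 4 → K) × (Fin 4 → K)).2, by
          rw [LinearMap.mem_ker]
          have hw : (LinearMap.pi fun r => t r (a, 0)) (w : (Fin 4 → K) × (Fin 4 → K)) = 0 :=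
            LinearMap.mem_ker.1 w.2
          have h1 := hsnd w w.2
          have : ((0 : Fin 4 → K), (w : (Fin 4 → K) × (Fin 4 → K)).2) = (w : _) := by
            rw [← h1]
          show (LinearMap.pi fun r => t r (a, 0)) (0, (w : (Fin 4 → K) × (Fin 4 → K)).2) = 0
          rw [this]; exact hw⟩
        map_add' := fun w w' => by ext; simp
        map_smul' := fun c w => by ext; simp }
    have hf : Function.Injective f := by
      intro w w' h
      have h2 : (w : (Fin 4 → K) × (Fin 4 → K)).2 = (w' : (Fin 4 → K) × (Fin 4 → K)).2 :=
        congrArg Subtype.val h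
      apply Subtype.ext
      exact Prod.ext (by rw [hsnd w w.2, hsnd w' w'.2]) h2
    calc 3 ≤ finrank K W := h3
      _ = finrank K (LinearMap.range f) := (LinearMap.finrank_range_of_inj hf).symm
      _ ≤ finrank K (LinearMap.ker A) := Submodule.finrank_le _
  have := minors_of_three_le_finrank_ker A h3' x x' r r'
  simpa only [hA] using this

/-- **Row symmetry `y₂ ↔ y₃`** (general index type). [folklore] -/
theorem hJ_yswap [Fintype ι] (c : ι → K)
    (t : ι → (((Fin 4 → K) × (Fin 4 → K)) →ₗ[K] ((Fin 4 → K) × (Fin 4 → K)) →ₗ[K] K))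
    (hJ : ∀ a b y₂ y₃ : Fin 4 → K,
      ∑ r, c r * (t r (a, b) (y₂, y₃)) ^ 2 = (Matrix.of ![a, b, y₂, y₃]).permanent) :
    ∀ a b y₂ y₃ : Fin 4 → K,
      ∑ r, c r * ((t r).compl₂ (LinearEquiv.prodComm K (Fin 4 → K) (Fin 4 → K)).toLinearMap
        (a, b) (y₂, y₃)) ^ 2 = (Matrix.of ![a, b, y₂, y₃]).permanent := by
  intro a b y₂ y₃
  have h := hJ a b y₃ y₂
  rw [per_swap_row₂₃] at h
  exact h

/-- The `a`-slot kernel of the `y₂ ↔ y₃`-swapped design is the swap of the kernel. [folklore] -/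
theorem mem_ker_yswap
    (t : ι → (((Fin 4 → K) × (Fin 4 → K)) →ₗ[K] ((Fin 4 → K) × (Fin 4 → K)) →ₗ[K] K))
    (u : (Fin 4 → K) × (Fin 4 → K)) (y : (Fin 4 → K) × (Fin 4 → K)) :
    y ∈ LinearMap.ker (LinearMap.pi fun r =>
        (t r).compl₂ (LinearEquiv.prodComm K (Fin 4 → K) (Fin 4 → K)).toLinearMap u) ↔
      (y.2, y.1) ∈ LinearMap.ker (LinearMap.pi fun r => t r u) := by
  simp only [LinearMap.mem_ker]
  constructor <;> intro h <;> funext r <;> have := congr_fun h r <;> simpa [Prod.swap] using this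

end Summit.ValiantsHypothesis.ValiantsHypothesis.Theorems.SymPencilPerFourInnerRankSlotAShapes

end
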